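import Summits.QuantumFields.BalabanUV.Beta.FP.PerfectColumnSharp
import Summits.QuantumFields.BalabanUV.Beta.FP.WindowedBlockMass
import Summits.QuantumFields.BalabanUV.Beta.FP.MixLoopPowerCountingMass
import Summits.QuantumFields.BalabanUV.Beta.FP.LegPairingBounds

/-!
# `BalabanUV.Beta.FP.PerfectColumnEngineLetters` — road «FP» for binder row D1, row **RHOA-6e** (owner, K-SIDE HALF): THE PERFECT MINIMISER
# COLUMNS IN THE EXACT LETTER SHAPES (J) ∕ (J′) ∕ (Δ) OF THE ROAD's J-CONTRACTION ENGINES, m-UNIFORMLY — what every (rem)∕(pp) supplier plugs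
# into `MixLoopPowerCountingMass.coarse_mix2_secondMoment_le` (letters `hJ`, `hJ'`), `MixLoopPowerCountingMassQuartic.coarse_secondMoment_of_majorant`,
# `CoarseContractionProfile.abs_biContract_le` ∕ `pp_of_pair` (profiles (P1)(P2)(PΔ)) at instance time, with every power of `N = Lc^m` DISPLAYED

HONEST DEPENDENCY (page 1, mandatory): continuum YM on T⁴ ⇐ BetaPertH ∧ nine spine estimates (0/9 proved); BetaPertH ⇐ (D1) ∧ (D4) ∧
CAP+tail; G-an2-4 gates asym, D1 and NE2/3/4.  HONEST FRAMING (cell contract, verbatim): «discharging `BetaPertH` makes Bałaban's UV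
stability UNCONDITIONAL — a real constructive-QFT result; it is NOT the continuum limit and NOT the Clay problem.»  THIS MODULE is [folklore]
bookkeeping (`‖·‖∞ ≤ |·|₁`, `(1+(x∕n)²)e^{−(c∕n)x} ≤ (1+16∕c²)e^{−(c∕(2n))x}`, one n-FREE coarse exponential sum) composed BY NAME with the tree's
IPROF-SHARP `FP/PerfectColumnSharp.colOf_KPerf_sharp` (gan24-p3-g19: the perfect column is `C·((Lc^m)⁵)⁻¹·e^{−(κ₀∕(4·Lc^m))|p|₁}` pointwise, its unit differences
`C′·((Lc^m)⁶)⁻¹·e^{…}`, ONE `(κ₀, C, C′)` for all `m ≥ 1`), `FP/WindowedBlockMass.sum_coarse_exp_le` (t4-ne7b-formalise-leaf-02-g22), `FP/MixLoopPowerCountingMass.sq_div_mul_exp_le`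
(owner g7) and `FP/LegPairingBounds.supNorm_le_l1`.  No `def`, no `def … : Prop`, nothing cited, 0 sorry.  WHAT IT IS FOR (R-FP-31 ∕ KER-γ (β)): the (rem)∕(pp)
engines index their contraction weights as `J b v` (fine `b`, coarse `v`) with letters (J) `|J b v| ≤ C_J·e^{−(δ∕n)‖b − n•v‖∞}`, (J′) `Σ_{v∈V}(1 + (‖b−n•v‖∞∕n)²)|J b v| ≤ C_J′`,
(PΔ) `|J(b−w) v − J b v| ≤ C_Δ·e^{−(δ∕n)‖b−n•v‖∞}`; here they are PROVED for `J b v := colOf (KPerf Lc (sfStep Lc) (smStep 3 Lc) m) κ l (N•v − b)`, `N = Lc^m`, with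
`C_J = C·N⁻⁵`, `C_Δ = C′·N⁻⁶` (unit step), `C_J′ = C·N⁻⁵·A(κ₀)` — so RHOA-6e's N-power ledger reads the K-side powers OFF THIS FILE (`N⁻⁵`, `N⁻⁵`, `N⁻⁶` before the
END's `N⁸`, i.e. `N⁻¹`, `N⁻¹`, `N⁻²` for the lattice-normalised `N⁴•colOf` of R-FP-31).  NOT an estimate of any constrained object beyond what IPROF-SHARP already proves;
0∕4 row-D1 binders; NOT `Mix_n = O(1)`, NOT hbook, NOT D1, NOT BetaPertH, NOT continuum, NOT Clay.

ABSOLUTE RULE (cell charter, verbatim): «No internally-minted statement may enter as a cited fact. Every hypothesis is either kernel-proved in this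
package or a verbatim quotation of a PUBLISHED theorem with page reference. The manuscript(s) under audit are NOT citable for their own disputed
steps — they are the thing under adjudication; programme-internal (2001/route/tribunal) claims are never citable.»

CONTENT.
* §1 [folklore] helpers: `exp_neg_l1_le_exp_neg_supNorm` (ℓ¹ rate ⟹ sup-norm rate), `one_add_sq_mul_exp_le` (`(1+(x∕n)²)e^{−(c∕n)x} ≤ (1+16∕c²)·e^{−(c∕(2n))x}`),
  `sum_coarse_weight_le` (`Σ_{v∈V}(1+(‖b−n•v‖∞∕n)²)e^{−(c∕n)‖b−n•v‖∞} ≤ (1+16∕c²)·e^{c∕2}·(1+480e^{c∕4}(4∕c)⁴)`, n-FREE, every finite `V`, every fine `b`).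
* §2 **`engineLetters_perfCol`** (`d = 3`, `2 ≤ Lc`): `∃ κ₀ C C′`, `0 < κ₀`, `0 ≤ C`, `0 ≤ C′`, for ALL `m ≥ 1` (with `N = Lc^m`): (J) sup profile in `‖b − N•v‖∞` with constant
  `C·N⁻⁵` and rate `κ₀∕(4N)`; (Δ) unit-step differences with `C′·N⁻⁶`; (J′) the running-leg coarse-moment letter with `C·N⁻⁵·(1+16∕(κ₀∕4)²)·e^{κ₀∕8}·(1+480e^{κ₀∕16}(16∕κ₀)⁴)`;
  and the three projections `letterJ_perfCol`, `letterJ'_perfCol`, `letterΔ_perfCol`.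
Provenance: road FP OWNER b2b-balaban-beta-d1-p3 gen 8 (prover-b2b-balaban-beta-d1-p3-g8-0), 2026-08-21, row RHOA-6e (K-side half); «not in print; our bookkeeping».
-/

noncomputable section

namespace Summit.QuantumFields.BalabanUV.Beta.FP.PerfectColumnEngineLetters

open Finset
open scoped BigOperators
open Literature.MathematicalPhysics.QuantumFieldTheory.Balaban1983to89
open Literature.MathematicalPhysics.QuantumFieldTheory.Balaban1983to89.Beta
open B12Sec2to5 (l1 l1_nonneg)
open DyadicShell (Pt supNorm)
open GradedBubbles (supNorm_neg)
open Summit.QuantumFields.BalabanUV.Beta.GAN24.CombesThomas (sfStep smStep)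
open Summit.QuantumFields.BalabanUV.Beta.FP.PerfectObjectsT (KPerf)
open Summit.QuantumFields.BalabanUV.Beta.FP.TransportInfinityM (colOf)
open Summit.QuantumFields.BalabanUV.Beta.FP.PerfectColumnSharp (colOf_KPerf_sharp)
open Summit.QuantumFields.BalabanUV.Beta.FP.WindowedBlockMass (sum_coarse_exp_le)
open Summit.QuantumFields.BalabanUV.Beta.FP.MixLoopPowerCounting (supNorm_cast_nonneg)
open Summit.QuantumFields.BalabanUV.Beta.FP.MixLoopPowerCountingMass (sq_div_mul_exp_le)
open Summit.QuantumFields.BalabanUV.Beta.FP.LegPairingBounds (supNorm_le_l1 supNorm_sub_comm)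

/-! ## §1 Helpers -/

/-- [folklore] An ℓ¹-rate exponential is below the sup-norm-rate one: `e^{−a|p|₁} ≤ e^{−a‖p‖∞}` for `a ≥ 0`. -/
theorem exp_neg_l1_le_exp_neg_supNorm {a : ℝ} (ha : 0 ≤ a) (p : Pt) :
    Real.exp (-a * l1 p) ≤ Real.exp (-a * (supNorm p : ℝ)) := by
  apply Real.exp_le_exp.mpr
  have h := supNorm_le_l1 p
  nlinarith

/-- [folklore] Absorbing the running-leg polynomial into half the rate: `(1 + (x∕n)²)·e^{−(c∕n)x} ≤ (1 + 16∕c²)·e^{−(c∕(2n))x}` (`c > 0`, `n ≥ 1`, `x ≥ 0`). -/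
theorem one_add_sq_mul_exp_le {c x : ℝ} {n : ℕ} (hc : 0 < c) (hn : 1 ≤ n) (hx : 0 ≤ x) :
    (1 + (x / n) ^ 2) * Real.exp (-(c / n) * x) ≤ (1 + 16 / c ^ 2) * Real.exp (-(c / (2 * n)) * x) := by
  have hn' : (0 : ℝ) < n := by exact_mod_cast hn
  have hsplit : Real.exp (-(c / n) * x) = Real.exp (-(c / (2 * n)) * x) * Real.exp (-(c / 2 / n) * x) := by
    rw [← Real.exp_add]; congr 1; field_simp; ring
  have hsq : (x / n) ^ 2 * Real.exp (-(c / 2 / n) * x) ≤ 4 / (c / 2) ^ 2 :=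
    sq_div_mul_exp_le (c := c / 2) (by positivity) hn hx
  have h16 : 4 / (c / 2) ^ 2 = 16 / c ^ 2 := by field_simp; ring
  have hE : 0 < Real.exp (-(c / (2 * n)) * x) := Real.exp_pos _
  have hE1 : Real.exp (-(c / 2 / n) * x) ≤ 1 := by
    apply Real.exp_le_one_iff.mpr
    have : 0 ≤ c / 2 / n * x := by positivity
    linarith
  rw [hsplit]
  calc (1 + (x / n) ^ 2) * (Real.exp (-(c / (2 * n)) * x) * Real.exp (-(c / 2 / n) * x))
      = Real.exp (-(c / (2 * n)) * x) * (Real.exp (-(c / 2 / n) * x) + (x / n) ^ 2 * Real.exp (-(c / 2 / n) * x)) := by ring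
    _ ≤ Real.exp (-(c / (2 * n)) * x) * (1 + 16 / c ^ 2) := by
        apply mul_le_mul_of_nonneg_left _ hE.le
        rw [← h16]
        exact add_le_add hE1 hsq
    _ = (1 + 16 / c ^ 2) * Real.exp (-(c / (2 * n)) * x) := by ring

/-- [folklore] **THE RUNNING-LEG COARSE SUM, n-FREE**: for every finite set `V` of coarse sites and every fine `b`,
`Σ_{v∈V} (1 + (‖b − n•v‖∞∕n)²)·e^{−(c∕n)‖b − n•v‖∞} ≤ (1 + 16∕c²)·e^{c∕2}·(1 + 480·e^{c∕4}·(4∕c)⁴)` (`WindowedBlockMass.sum_coarse_exp_le` at rate `c∕2`). -/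
theorem sum_coarse_weight_le {c : ℝ} (hc : 0 < c) {n : ℕ} (hn : 1 ≤ n) (V : Finset Pt) (b : Pt) :
    ∑ v ∈ V, (1 + ((supNorm (b - (n : ℤ) • v) : ℝ) / n) ^ 2) * Real.exp (-(c / n) * (supNorm (b - (n : ℤ) • v) : ℝ))
      ≤ (1 + 16 / c ^ 2) * (Real.exp (c / 2) * (1 + 480 * Real.exp (c / 2 / 2) * (2 / (c / 2)) ^ 4)) := by
  have hterm : ∀ v ∈ V, (1 + ((supNorm (b - (n : ℤ) • v) : ℝ) / n) ^ 2) * Real.exp (-(c / n) * (supNorm (b - (n : ℤ) • v) : ℝ))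
      ≤ (1 + 16 / c ^ 2) * Real.exp (-(c / 2 / n) * (supNorm ((n : ℤ) • v - b) : ℝ)) := by
    intro v _
    have h := one_add_sq_mul_exp_le hc hn (supNorm_cast_nonneg (b - (n : ℤ) • v))
    rw [supNorm_sub_comm ((n : ℤ) • v) b, show c / 2 / (n : ℝ) = c / (2 * n) by rw [div_div]]
    exact h
  calc ∑ v ∈ V, (1 + ((supNorm (b - (n : ℤ) • v) : ℝ) / n) ^ 2) * Real.exp (-(c / n) * (supNorm (b - (n : ℤ) • v) : ℝ))
      ≤ ∑ v ∈ V, (1 + 16 / c ^ 2) * Real.exp (-(c / 2 / n) * (supNorm ((n : ℤ) • v - b) : ℝ)) := Finset.sum_le_sum hterm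
    _ = (1 + 16 / c ^ 2) * ∑ v ∈ V, Real.exp (-(c / 2 / n) * (supNorm ((n : ℤ) • v - b) : ℝ)) := by rw [Finset.mul_sum]
    _ ≤ (1 + 16 / c ^ 2) * (Real.exp (c / 2) * (1 + 480 * Real.exp (c / 2 / 2) * (2 / (c / 2)) ^ 4)) :=
        mul_le_mul_of_nonneg_left (sum_coarse_exp_le (δ := c / 2) (by positivity) hn V b) (by positivity)

/-! ## §2 The perfect columns in the engines' letter shapes -/

section Perfect

variable {Lc : ℕ} [NeZero Lc]

/-- **THE PERFECT MINIMISER COLUMNS IN THE (J) ∕ (Δ) ∕ (J′) SHAPES OF THE ROAD's J-CONTRACTION ENGINES, m-UNIFORMLY** [our object] (`d = 3`, `2 ≤ Lc`):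
there are `κ₀ > 0`, `C, C′ ≥ 0` such that for ALL `m ≥ 1`, with `N = Lc^m` and `J b v := colOf (KPerf Lc (sfStep Lc) (smStep 3 Lc) m) κ l (N•v − b)`:
(J) `|J b v| ≤ C·N⁻⁵·e^{−((κ₀∕4)∕N)·‖b − N•v‖∞}`; (Δ) `|J (b − e_ν) v − J b v| ≤ C′·N⁻⁶·e^{−((κ₀∕4)∕N)·‖b − N•v‖∞}` (the profile of the UNSHIFTED point, as the pair currency
wants); (J′) `Σ_{v∈V}(1 + (‖b − N•v‖∞∕N)²)·|J b v| ≤ C·N⁻⁵·(1 + 16∕(κ₀∕4)²)·e^{κ₀∕8}·(1 + 480·e^{κ₀∕16}·(2∕(κ₀∕8))⁴)` for every finite `V`.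
All three are IPROF-SHARP (`PerfectColumnSharp.colOf_KPerf_sharp`) read in sup-norm distance (`‖·‖∞ ≤ |·|₁`) plus §1. -/
theorem engineLetters_perfCol (hLc : 2 ≤ Lc) :
    ∃ κ₀ C C' : ℝ, 0 < κ₀ ∧ 0 ≤ C ∧ 0 ≤ C' ∧ ∀ m : ℕ, 1 ≤ m →
      (∀ (κ l : Fin 4) (b v : Pt),
        |colOf (KPerf (d := 3) Lc (sfStep Lc) (smStep 3 Lc) m) κ l (((Lc ^ m : ℕ) : ℤ) • v - b)|
          ≤ C * (((Lc ^ m : ℕ) : ℝ) ^ 5)⁻¹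
              * Real.exp (-(κ₀ / 4 / ((Lc ^ m : ℕ) : ℝ)) * (supNorm (b - ((Lc ^ m : ℕ) : ℤ) • v) : ℝ))) ∧
      (∀ (κ l : Fin 4) (b v : Pt) (ν : Fin 4),
        |colOf (KPerf (d := 3) Lc (sfStep Lc) (smStep 3 Lc) m) κ l (((Lc ^ m : ℕ) : ℤ) • v - b + Pi.single ν 1)
            - colOf (KPerf (d := 3) Lc (sfStep Lc) (smStep 3 Lc) m) κ l (((Lc ^ m : ℕ) : ℤ) • v - b)|
          ≤ C' * (((Lc ^ m : ℕ) : ℝ) ^ 6)⁻¹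
              * Real.exp (-(κ₀ / 4 / ((Lc ^ m : ℕ) : ℝ)) * (supNorm (b - ((Lc ^ m : ℕ) : ℤ) • v) : ℝ))) ∧
      (∀ (κ l : Fin 4) (b : Pt) (V : Finset Pt),
        ∑ v ∈ V, (1 + ((supNorm (b - ((Lc ^ m : ℕ) : ℤ) • v) : ℝ) / ((Lc ^ m : ℕ) : ℝ)) ^ 2)
            * |colOf (KPerf (d := 3) Lc (sfStep Lc) (smStep 3 Lc) m) κ l (((Lc ^ m : ℕ) : ℤ) • v - b)|
          ≤ C * (((Lc ^ m : ℕ) : ℝ) ^ 5)⁻¹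
              * ((1 + 16 / (κ₀ / 4) ^ 2)
                * (Real.exp (κ₀ / 4 / 2) * (1 + 480 * Real.exp (κ₀ / 4 / 2 / 2) * (2 / (κ₀ / 4 / 2)) ^ 4)))) := by
  obtain ⟨κ₀, C, C', hκ₀, hC, hC', hsup, hsub⟩ := colOf_KPerf_sharp (Lc := Lc) hLc
  refine ⟨κ₀, C, C', hκ₀, hC, hC', fun m hm => ?_⟩
  have hLc1 : 1 ≤ Lc := le_trans (by norm_num) hLc
  have hN1 : 1 ≤ Lc ^ m := Nat.one_le_pow m Lc hLc1
  have hNR : (((Lc ^ m : ℕ) : ℝ)) = (Lc : ℝ) ^ m := by push_cast; ring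
  have hNpos : (0 : ℝ) < ((Lc ^ m : ℕ) : ℝ) := by exact_mod_cast hN1
  -- the rate conversion ℓ¹ → sup norm, at the reflected point
  have hrate : ∀ b v : Pt, Real.exp (-(κ₀ / (4 * ((Lc ^ m : ℕ) : ℝ))) * l1 (((Lc ^ m : ℕ) : ℤ) • v - b))
      ≤ Real.exp (-(κ₀ / 4 / ((Lc ^ m : ℕ) : ℝ)) * (supNorm (b - ((Lc ^ m : ℕ) : ℤ) • v) : ℝ)) := by
    intro b v
    have ha : 0 ≤ κ₀ / 4 / ((Lc ^ m : ℕ) : ℝ) := by positivity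
    have h := exp_neg_l1_le_exp_neg_supNorm ha (((Lc ^ m : ℕ) : ℤ) • v - b)
    rw [supNorm_sub_comm (((Lc ^ m : ℕ) : ℤ) • v) b] at h
    have e : κ₀ / (4 * ((Lc ^ m : ℕ) : ℝ)) = κ₀ / 4 / ((Lc ^ m : ℕ) : ℝ) := by rw [div_div]
    rw [e]
    exact h
  refine ⟨fun κ l b v => ?_, fun κ l b v ν => ?_, fun κ l b V => ?_⟩
  · -- (J)
    have h := hsup m hm κ l (((Lc ^ m : ℕ) : ℤ) • v - b)
    rw [← hNR] at h
    exact h.trans (mul_le_mul_of_nonneg_left (hrate b v) (by positivity))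
  · -- (Δ)
    have h := hsub m hm κ l (((Lc ^ m : ℕ) : ℤ) • v - b) ν
    rw [← hNR] at h
    exact h.trans (mul_le_mul_of_nonneg_left (hrate b v) (by positivity))
  · -- (J′)
    have hJ : ∀ v, |colOf (KPerf (d := 3) Lc (sfStep Lc) (smStep 3 Lc) m) κ l (((Lc ^ m : ℕ) : ℤ) • v - b)|
        ≤ C * (((Lc ^ m : ℕ) : ℝ) ^ 5)⁻¹
            * Real.exp (-(κ₀ / 4 / ((Lc ^ m : ℕ) : ℝ)) * (supNorm (b - ((Lc ^ m : ℕ) : ℤ) • v) : ℝ)) := by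
      intro v
      have h := hsup m hm κ l (((Lc ^ m : ℕ) : ℤ) • v - b)
      rw [← hNR] at h
      exact h.trans (mul_le_mul_of_nonneg_left (hrate b v) (by positivity))
    have hK : 0 ≤ C * (((Lc ^ m : ℕ) : ℝ) ^ 5)⁻¹ := by positivity
    calc ∑ v ∈ V, (1 + ((supNorm (b - ((Lc ^ m : ℕ) : ℤ) • v) : ℝ) / ((Lc ^ m : ℕ) : ℝ)) ^ 2)
            * |colOf (KPerf (d := 3) Lc (sfStep Lc) (smStep 3 Lc) m) κ l (((Lc ^ m : ℕ) : ℤ) • v - b)|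
        ≤ ∑ v ∈ V, (1 + ((supNorm (b - ((Lc ^ m : ℕ) : ℤ) • v) : ℝ) / ((Lc ^ m : ℕ) : ℝ)) ^ 2)
            * (C * (((Lc ^ m : ℕ) : ℝ) ^ 5)⁻¹
              * Real.exp (-(κ₀ / 4 / ((Lc ^ m : ℕ) : ℝ)) * (supNorm (b - ((Lc ^ m : ℕ) : ℤ) • v) : ℝ))) :=
          Finset.sum_le_sum fun v _ => mul_le_mul_of_nonneg_left (hJ v) (by positivity)
      _ = C * (((Lc ^ m : ℕ) : ℝ) ^ 5)⁻¹
            * ∑ v ∈ V, (1 + ((supNorm (b - ((Lc ^ m : ℕ) : ℤ) • v) : ℝ) / ((Lc ^ m : ℕ) : ℝ)) ^ 2)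
              * Real.exp (-(κ₀ / 4 / ((Lc ^ m : ℕ) : ℝ)) * (supNorm (b - ((Lc ^ m : ℕ) : ℤ) • v) : ℝ)) := by
          rw [Finset.mul_sum]
          exact Finset.sum_congr rfl fun v _ => by ring
      _ ≤ C * (((Lc ^ m : ℕ) : ℝ) ^ 5)⁻¹
            * ((1 + 16 / (κ₀ / 4) ^ 2)
              * (Real.exp (κ₀ / 4 / 2) * (1 + 480 * Real.exp (κ₀ / 4 / 2 / 2) * (2 / (κ₀ / 4 / 2)) ^ 4))) :=
          mul_le_mul_of_nonneg_left (sum_coarse_weight_le (c := κ₀ / 4) (by positivity) hN1 V b) hK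

/-- **(J) ALONE** [our object]: the sup profile of the perfect columns in the engines' shape, m-uniform. -/
theorem letterJ_perfCol (hLc : 2 ≤ Lc) :
    ∃ κ₀ C : ℝ, 0 < κ₀ ∧ 0 ≤ C ∧ ∀ m : ℕ, 1 ≤ m → ∀ (κ l : Fin 4) (b v : Pt),
      |colOf (KPerf (d := 3) Lc (sfStep Lc) (smStep 3 Lc) m) κ l (((Lc ^ m : ℕ) : ℤ) • v - b)|
        ≤ C * (((Lc ^ m : ℕ) : ℝ) ^ 5)⁻¹
            * Real.exp (-(κ₀ / 4 / ((Lc ^ m : ℕ) : ℝ)) * (supNorm (b - ((Lc ^ m : ℕ) : ℤ) • v) : ℝ)) := by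
  obtain ⟨κ₀, C, _, hκ₀, hC, _, h⟩ := engineLetters_perfCol (Lc := Lc) hLc
  exact ⟨κ₀, C, hκ₀, hC, fun m hm => (h m hm).1⟩

/-- **(Δ) ALONE** [our object]: unit-step differences of the perfect columns gain one power of `N`, profile of the unshifted point, m-uniform. -/
theorem letterΔ_perfCol (hLc : 2 ≤ Lc) :
    ∃ κ₀ C' : ℝ, 0 < κ₀ ∧ 0 ≤ C' ∧ ∀ m : ℕ, 1 ≤ m → ∀ (κ l : Fin 4) (b v : Pt) (ν : Fin 4),
      |colOf (KPerf (d := 3) Lc (sfStep Lc) (smStep 3 Lc) m) κ l (((Lc ^ m : ℕ) : ℤ) • v - b + Pi.single ν 1)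
          - colOf (KPerf (d := 3) Lc (sfStep Lc) (smStep 3 Lc) m) κ l (((Lc ^ m : ℕ) : ℤ) • v - b)|
        ≤ C' * (((Lc ^ m : ℕ) : ℝ) ^ 6)⁻¹
            * Real.exp (-(κ₀ / 4 / ((Lc ^ m : ℕ) : ℝ)) * (supNorm (b - ((Lc ^ m : ℕ) : ℤ) • v) : ℝ)) := by
  obtain ⟨κ₀, _, C', hκ₀, _, hC', h⟩ := engineLetters_perfCol (Lc := Lc) hLc
  exact ⟨κ₀, C', hκ₀, hC', fun m hm => (h m hm).2.1⟩

/-- **(J′) ALONE** [our object]: the running-leg coarse-moment letter of the perfect columns, `C·N⁻⁵·A(κ₀)` with `A` displayed and n-free, m-uniform. -/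
theorem letterJ'_perfCol (hLc : 2 ≤ Lc) :
    ∃ κ₀ C : ℝ, 0 < κ₀ ∧ 0 ≤ C ∧ ∀ m : ℕ, 1 ≤ m → ∀ (κ l : Fin 4) (b : Pt) (V : Finset Pt),
      ∑ v ∈ V, (1 + ((supNorm (b - ((Lc ^ m : ℕ) : ℤ) • v) : ℝ) / ((Lc ^ m : ℕ) : ℝ)) ^ 2)
          * |colOf (KPerf (d := 3) Lc (sfStep Lc) (smStep 3 Lc) m) κ l (((Lc ^ m : ℕ) : ℤ) • v - b)|
        ≤ C * (((Lc ^ m : ℕ) : ℝ) ^ 5)⁻¹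
            * ((1 + 16 / (κ₀ / 4) ^ 2)
              * (Real.exp (κ₀ / 4 / 2) * (1 + 480 * Real.exp (κ₀ / 4 / 2 / 2) * (2 / (κ₀ / 4 / 2)) ^ 4))) := by
  obtain ⟨κ₀, C, _, hκ₀, hC, _, h⟩ := engineLetters_perfCol (Lc := Lc) hLc
  exact ⟨κ₀, C, hκ₀, hC, fun m hm => (h m hm).2.2⟩

end Perfect

end Summit.QuantumFields.BalabanUV.Beta.FP.PerfectColumnEngineLetters

end
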